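import Literature.MathematicalPhysics.QuantumFieldTheory.Balaban1983to89.B11Eq98V0LettersFlat
import Literature.MathematicalPhysics.QuantumFieldTheory.Balaban1983to89.B9TorusCalculus

/-!
# BalabanUVNodes ∕ K0⁷ stub 1 (`stub_prop8StepCoP13`), sub-target S4b — [Balaban1985Variational] PROP. 4's V₀-GROUP CURRENT `(δ/δA′)V₀` AT THE SETUP
# TORUS `PBond P 0`, FLAT BACKGROUND, ONE LEVEL: the site dictionary `Site P j ≃ TSite P.d (…)` to lit-balaban's carrier, and the V₀ summand of the
# (158) map `W` in the POINTWISE (98)-slot shape of the route `UnitScaleTilt`'s `FlatSmallSolution158` (`hWq` ∕ `hWd`), with its (63)∕(27) certificate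

Cell `pub-ymgap`, width seat `pub-ymgap-k0-s1-w2` (g0; HUMAN RULING D-0149, director-ym №197), K0⁷ **stmt-QuantumFields-20541**, V18 stub 1
`stub_prop8StepCoP13` (= [15] Prop. 8 ∕ Sect. F one pass `HalvingStepTop`); plan g77∕g78 W-SEAT-START-LIST §k0-s1 item w2 = S4b «the (δ∕δA′)V pieces at
objects».  `--kind proof --supports stmt-QuantumFields-20541 --as helper`; count-neutral.  [15] = T. Bałaban, CMP **102** (1985) 277–309.

WHY.  Sect. F's critical-point equation (158) p. 302 «A₁ + G̃((δ/δA′)V)(A₁ + HB) = 0» is typed at the record's fine torus by the route `UnitScaleTilt`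
(`Thm/UnitScaleTiltProp8FlatSmallSolution158`: every `Params`, fields `PBond P 0 → V`, weight `c`) and read at the T⁴ record by k0-s1-w1
(`Thm/BalabanUVNodesK0Stub1FlatSmallSolution158AtRecord`), with `W = (δ/δA′)V` an ABSTRACT map carrying Prop. 4's (98) in the POINTWISE shape
`hWq : sup‖Y‖ ≤ r ∧ c·sup‖Y(s+e_ν,μ) − Y(s,μ)‖ ≤ r ∧ r < a₃ ⇒ sup‖W Y‖ ≤ C₄r²`, `hWd : DifferentiableOn`.  The V₀-group of `W` ((90)–(96): the functional
derivative of the remainder `V₀` of the action expansion (26)) has its (98)-slot PROVED with a lattice-uniform constant at the flat background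
(`B11Eq98V0LettersFlat.quadAnalytic_curV0_flat_oneLevel`, this seat, p584681) — but on lit-balaban's carrier `Space115 … (Bond d Pd)`, `Bond d Pd = TSite d Pd × Fin d`,
`TSite d Pd = Π i, Fin (Pd i)`, shifts `Tsh`, NOT on `Site P 0 = Fin d → ZMod (sitesPerDir 0)` with `Site.shift`.  THIS FILE transports it: a site dictionary
intertwining the steps (coordinatewise `ZMod.finEquiv`), the pointwise reading of the (115)∕(−3) sizes at one level `k` (weights `(L^k·L^{−k})ⁿ = 1`, flat
`∇ = L^k ×` forward difference), and the V₀ summand of `W` on `PBond P 0 → 𝔸` with `hWq` at `a₃ = 1/16`, `C₄ = (d−1)‖ρ‖(64+138‖τ‖)`, `hWd` (entire), and the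
pairing certificate (63)∕(27) «⟨W(Y), δ⟩ = (d/dt)V₀(Y + tδ)|₀» transported from `B11Eq63V0GroupCurrent.bondPair_curV0` — so `W` IS `(δ/δA)V₀`, not a junk inhabitant.

CONTENTS (theorems only; 0 `def`; the dictionary and `W` are EXISTENTIALLY packaged with their defining equations displayed).
§1 `tshift_eq_update`, ★ `exists_siteDictionary` (`∃ e : Site P j ≃ TSite P.d (fun _ => P.sitesPerDir j), e (x + e_μ) = Tsh_μ (e x)`), `dict_unshift`,
   `dict_symm_shift`, `dict_symm_unshift`, `dict_shiftEquiv`, `dict_torusT` ∕ `dict_symm_torusT` ∕ `dict_symm_torusT_symm` (n07-w1's `torusT P j` currency: ONE rewrite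
   each way).  §2 `levWeight_top`, `nabla115_one_apply`, ★ `norm115_transport_le` (UST's two pointwise letters ⇒
   (115)-size `≤ r` of the transported field), `apply_norm_le_negSize`.  §3 pv27's Sect.-B letters are NATURAL under a site equivalence intertwining the
   shifts (generic `S ≃ S′`): `plaqU_transport`, `lettersA_transport`, `V0p_transport`, ★ `V0_transport` (`V₀[T′, U∘e⁻¹](A∘e⁻¹) = V₀[T, U](A)`, via (30)
   `eq30a`), `bondPair_transport`.  §4 ★★ `exists_W_V0_flat` — for every `Params` with `4 ≤ d`, every level `k`, every complete unital finite-dimensional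
   `*`-algebra `𝔸` and letters `ρ, τ` (dualising `τ(ρ(ℓ)X) = ℓ X`, tracial, `*`-compatible, contractive): `∃ e W`, the dictionary law, the DEFINING
   EQUATION `W Y b = curV0 ρ τ 1 (Y ∘ e⁻¹) (e b₋, dir b)`, `hWq`, `Differentiable ℂ W`, the (63)∕(27) certificate on lit-balaban's carrier AND read back on
   the Setup torus: `bondPair η d τ (W Y) δ = (d/dt) V₀[shiftEquiv, 1](Y + tδ)|₀` with pv27's generic `V0` at `LatticeFieldCalculus.shiftEquiv` (= `torusT P 0`)
   and the flat background `fun _ _ => 1` — the currency of n07-w1's Sect.-B-at-objects expansion.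

HONEST FRAMING.  The V₀ SUMMAND ONLY: Sect. F's `W` ((157)) also carries `−∂*∂HD(A′) − 𝔇*(A′)H*∂*∂A′ + 𝔇*H*∂*∂HD(A′)` (needs S1∕S2's `H`, (47) at objects —
NOT here); the record's fibre algebra `M₂(ℂ)` with `τ₂ = ½tr` (n07-w1's `trN_*`) and its dualiser is ONE instance of `(𝔸, ρ, τ)` (not spelled here); the
identification of the flat datum `fun _ _ => 1` with n07-w1's `dirForm (cfgGL N 1)` is theirs to spell (one `Units` line).  Nothing of [15]'s analysis beyond the cited kernel theorems; K0⁷ OPEN; N07 NOT discharged; counts unmoved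
(5∕27); one finite 𝕋⁴ programme at fixed ε — R4 closes the conditional rung `BalabanLadder.UV` only; the YM mass gap (Clay) is NOT proved by any of this;
nothing continuum ∕ ℝ⁴ ∕ OS.  0 `sorry`, 0 `def`, 0 `instance`, standard axioms.
-/

noncomputable section

namespace Summit.QuantumFields.YangMills.Theorems.K0Stub1V0SlotAtRecord

open Literature.MathematicalPhysics.QuantumFieldTheory.Balaban1983to89
open B4Sect5Torus (TSite)
open B9SectCLatticeCarrier (Bond)
open B11Eq115Space
open B11Eq111FrakG (nabla115 nabla115_apply)

/-! ## §1 The site dictionary `Site P j ≃ TSite P.d (fun _ => P.sitesPerDir j)` intertwining the unit steps -/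

/-- The TSite step `x ↦ x + e_k` is `+ 1` in the ring `Fin n` (coordinate `k`). [folklore] -/
theorem tshift_eq_update {d : ℕ} {Pd : Fin d → ℕ} [∀ i, NeZero (Pd i)] (k : Fin d) (x : TSite d Pd) :
    B9SectCLatticeCarrier.shift k x = Function.update x k (x k + 1) := by
  ext i
  by_cases h : i = k
  · subst h
    rw [B9SectCLatticeCarrier.shift, Function.update_self, Function.update_self, Fin.val_add]
    simp [Nat.add_mod]
  · rw [B9SectCLatticeCarrier.shift, Function.update_of_ne h, Function.update_of_ne h]

/-- **THE SITE DICTIONARY EXISTS**: coordinatewise `ZMod n ≃+* Fin n` (`ZMod.finEquiv`), intertwining `Site.shift` with the TSite step `B9SectCLatticeCarrier.shift`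
(both are `+1 mod n`). [folklore] [cite: Balaban1987RG1, (0.1) p.251 (the torus sites; bookkeeping)] -/
theorem exists_siteDictionary (P : Params) (j : ℕ) :
    ∃ e : Site P j ≃ TSite P.d (fun _ => P.sitesPerDir j), ∀ (x : Site P j) (μ : Fin P.d),
      e (x.shift μ) = B9SectCLatticeCarrier.shift μ (e x) := by
  haveI : ∀ i : Fin P.d, NeZero ((fun _ : Fin P.d => P.sitesPerDir j) i) := fun _ => inferInstance
  let e : Site P j ≃ TSite P.d (fun _ => P.sitesPerDir j) :=
    Equiv.piCongrRight fun _ => (ZMod.finEquiv (P.sitesPerDir j)).symm.toEquiv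
  have happ : ∀ (y : Site P j) (i : Fin P.d), e y i = (ZMod.finEquiv (P.sitesPerDir j)).symm (y i) := fun _ _ => rfl
  refine ⟨e, fun x μ => ?_⟩
  funext i
  apply Fin.ext
  by_cases h : i = μ
  · subst h
    rw [B9SectCLatticeCarrier.shift_apply_val, happ, happ, Site.shift, Function.update_self, map_add, map_one,
      Fin.val_add, Fin.val_one', Nat.add_mod_mod]
  · rw [B9SectCLatticeCarrier.shift_apply_ne h, happ, happ, Site.shift, Function.update_of_ne h]

section Dict

variable {P : Params} {j : ℕ} (e : Site P j ≃ TSite P.d (fun _ => P.sitesPerDir j))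

/-- A dictionary intertwining the forward steps intertwines the backward steps. [folklore] -/
theorem dict_unshift (he : ∀ (x : Site P j) (μ : Fin P.d), e (x.shift μ) = B9SectCLatticeCarrier.shift μ (e x))
    (x : Site P j) (μ : Fin P.d) : e (x.unshift μ) = B9SectCLatticeCarrier.unshift μ (e x) := by
  have h := he (x.unshift μ) μ
  have h2 : (x.unshift μ).shift μ = x := (LatticeFieldCalculus.shiftEquiv μ).apply_symm_apply x
  rw [h2] at h
  rw [h, B9SectCLatticeCarrier.unshift_shift]

/-- The inverse dictionary intertwines the forward steps. [folklore] -/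
theorem dict_symm_shift (he : ∀ (x : Site P j) (μ : Fin P.d), e (x.shift μ) = B9SectCLatticeCarrier.shift μ (e x))
    (y : TSite P.d (fun _ => P.sitesPerDir j)) (μ : Fin P.d) :
    e.symm (B9SectCLatticeCarrier.shift μ y) = (e.symm y).shift μ := by
  apply e.injective
  rw [Equiv.apply_symm_apply, he, Equiv.apply_symm_apply]

/-- The inverse dictionary intertwines the backward steps. [folklore] -/
theorem dict_symm_unshift (he : ∀ (x : Site P j) (μ : Fin P.d), e (x.shift μ) = B9SectCLatticeCarrier.shift μ (e x))
    (y : TSite P.d (fun _ => P.sitesPerDir j)) (μ : Fin P.d) :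
    e.symm (B9SectCLatticeCarrier.unshift μ y) = (e.symm y).unshift μ := by
  apply e.injective
  rw [Equiv.apply_symm_apply, dict_unshift e he, Equiv.apply_symm_apply]

/-- The dictionary in the `Equiv.Perm` currency: `e ∘ shiftEquiv μ = Tsh μ ∘ e`. [folklore] -/
theorem dict_shiftEquiv (he : ∀ (x : Site P j) (μ : Fin P.d), e (x.shift μ) = B9SectCLatticeCarrier.shift μ (e x))
    (x : Site P j) (μ : Fin P.d) :
    e (LatticeFieldCalculus.shiftEquiv μ x) = B11Eq90V0primeCurrent.Tsh μ (e x) := he x μ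

/-- **n07-w1's currency**: `e (torusT P j μ x) = Tsh μ (e x)` — pv27-at-`torusT` statements (Sect. B at objects) and lit-balaban's `Tsh`-statements meet in
this one rewrite (`B9TorusCalculus.torusT P j μ = shiftEquiv μ`). [folklore] -/
theorem dict_torusT (he : ∀ (x : Site P j) (μ : Fin P.d), e (x.shift μ) = B9SectCLatticeCarrier.shift μ (e x))
    (μ : Fin P.d) (x : Site P j) :
    e (B9TorusCalculus.torusT P j μ x) = B11Eq90V0primeCurrent.Tsh μ (e x) := he x μ

/-- … and for the inverse dictionary: `e⁻¹ (Tsh μ y) = torusT P j μ (e⁻¹ y)`. [folklore] -/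
theorem dict_symm_torusT (he : ∀ (x : Site P j) (μ : Fin P.d), e (x.shift μ) = B9SectCLatticeCarrier.shift μ (e x))
    (μ : Fin P.d) (y : TSite P.d (fun _ => P.sitesPerDir j)) :
    e.symm (B11Eq90V0primeCurrent.Tsh μ y) = B9TorusCalculus.torusT P j μ (e.symm y) := dict_symm_shift e he y μ

/-- … backward steps: `e⁻¹ ((Tsh μ)⁻¹ y) = (torusT P j μ)⁻¹ (e⁻¹ y)`. [folklore] -/
theorem dict_symm_torusT_symm (he : ∀ (x : Site P j) (μ : Fin P.d), e (x.shift μ) = B9SectCLatticeCarrier.shift μ (e x))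
    (μ : Fin P.d) (y : TSite P.d (fun _ => P.sitesPerDir j)) :
    e.symm ((B11Eq90V0primeCurrent.Tsh μ).symm y) = (B9TorusCalculus.torusT P j μ).symm (e.symm y) := dict_symm_unshift e he y μ

end Dict

/-! ## §2 Transport of bond fields and the pointwise reading of the (115)/(−3) sizes at ONE level of weight `1` -/

section Transport

variable {P : Params}

/-- The one-level weights at the top: `(L^k·L^{−k})ⁿ = 1` (print p. 300 «we assume that j = k», `Lᵏη = 1`). [cite: Balaban1985Variational, p.286, p.300] -/
theorem levWeight_top (hL : (P.L : ℝ) ≠ 0) (k n : ℕ) {ι : Type*} (i : ι) :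
    levWeight (P.L : ℝ) (((P.L : ℝ))⁻¹ ^ k) (fun _ : ι => k) n i = 1 := by
  rw [levWeight_apply, ← mul_pow, mul_inv_cancel₀ hL, one_pow, one_pow]

variable {𝔸 : Type*} [NormedRing 𝔸] [NormedAlgebra ℂ 𝔸]

/-- At the flat background the reference derivative `nabla115 η 1` is `η⁻¹ ×` the plain forward difference (`R(1) = id`). [cite: Balaban1985BackgroundPropagators, (3.3) p.391] -/
theorem nabla115_one_apply {d : ℕ} {Pd : Fin d → ℕ} (η : ℝ) (A : Bond d Pd → 𝔸) (b : Bond d Pd) (ν : Fin d) :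
    nabla115 η (1 : Bond d Pd → 𝔸ˣ) A (b, ν) =
      ((η : ℂ))⁻¹ • (A (B9SectCLatticeCarrier.btgt b, ν) - A (B9SectCLatticeCarrier.bpos b, ν)) := by
  rw [nabla115_apply, Pi.one_apply, Units.val_one, inv_one, Units.val_one, one_mul, mul_one]

/-- **THE (115) SIZE OF A TRANSPORTED FIELD, READ POINTWISE ON THE SETUP TORUS** (one level `k`, `L := P.L`, `η := L^{−k}`, weights `1`, flat `∇`):
if `‖Y b‖ ≤ r` and `L^k·‖Y⟨s + e_ν, μ⟩ − Y⟨s, μ⟩‖ ≤ r` everywhere (UST `FlatSmallSolution158`'s two pointwise letters, `c = L^k`) then the transported field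
`Y ∘ e⁻¹` has (115)-size `≤ r`. [cite: Balaban1985Variational, (115) p.294] -/
theorem norm115_transport_le (e : Site P 0 ≃ TSite P.d (fun _ => P.sitesPerDir 0))
    (he : ∀ (x : Site P 0) (μ : Fin P.d), e (x.shift μ) = B9SectCLatticeCarrier.shift μ (e x))
    (k : ℕ) [Fact ((0 : ℝ) < (P.L : ℝ))] [Fact ((0 : ℝ) < ((P.L : ℝ))⁻¹ ^ k)]
    (Y : PBond P 0 → 𝔸) {r : ℝ} (hr : 0 ≤ r) (h0 : ∀ b, ‖Y b‖ ≤ r)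
    (h1 : ∀ (s : Site P 0) (μ ν : Fin P.d), (P.L : ℝ) ^ k * ‖Y ⟨s.shift ν, μ⟩ - Y ⟨s, μ⟩‖ ≤ r) :
    ‖(JetSup.equiv (levWeight (P.L : ℝ) (((P.L : ℝ))⁻¹ ^ k) (fun _ : Bond P.d (fun _ => P.sitesPerDir 0) => k) 1)
        (levWeight (P.L : ℝ) (((P.L : ℝ))⁻¹ ^ k) (fun _ : Bond P.d (fun _ => P.sitesPerDir 0) × Fin P.d => k) 2)
        (nabla115 (((P.L : ℝ))⁻¹ ^ k) (1 : Bond P.d (fun _ => P.sitesPerDir 0) → 𝔸ˣ))).symm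
        (fun b => Y ⟨e.symm b.1, b.2⟩)‖ ≤ r := by
  have hL : (0 : ℝ) < (P.L : ℝ) := by exact_mod_cast P.L_pos
  rw [JetSup.norm_le_iff_pointwise hr]
  refine ⟨fun b => ?_, fun p => ?_⟩
  · rw [levWeight_top hL.ne', one_mul, Equiv.apply_symm_apply]
    exact h0 _
  · obtain ⟨b, ν⟩ := p
    rw [levWeight_top hL.ne', one_mul, Equiv.apply_symm_apply, nabla115_one_apply, norm_smul, norm_inv, Complex.norm_real,
      Real.norm_of_nonneg (pow_pos (inv_pos.mpr hL) k).le, inv_pow, inv_inv]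
    have hs : e.symm (B9SectCLatticeCarrier.btgt b) = (e.symm b.1).shift b.2 := dict_symm_shift e he b.1 b.2
    rw [hs]
    exact h1 (e.symm b.1) ν b.2

omit [NormedAlgebra ℂ 𝔸] in
/-- **A (−3)-SIZE OF WEIGHT `1` BOUNDS EVERY VALUE**: `‖f b‖ ≤ ‖f‖₍₋₃₎` at one level `k`, `η = L^{−k}`. [cite: Balaban1985Variational, (98) p.293, p.286] -/
theorem apply_norm_le_negSize (k : ℕ) [Fact ((0 : ℝ) < (P.L : ℝ))] [Fact ((0 : ℝ) < ((P.L : ℝ))⁻¹ ^ k)]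
    (f : NegSize (P.L : ℝ) (((P.L : ℝ))⁻¹ ^ k) (fun _ : Bond P.d (fun _ => P.sitesPerDir 0) => k) 3 𝔸)
    (b : Bond P.d (fun _ => P.sitesPerDir 0)) : ‖NegSup.equiv _ 𝔸 f b‖ ≤ ‖f‖ := by
  have hL : (0 : ℝ) < (P.L : ℝ) := by exact_mod_cast P.L_pos
  have h := NegSup.weight_mul_norm_apply_le f b
  rwa [levWeight_top hL.ne', one_mul] at h

end Transport


/-! ## §3 pv27's Sect.-B letters are NATURAL under a site equivalence intertwining the shifts: `V₀`, the pairing, read on either carrier -/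

section Natural

variable {𝔸 : Type*} [NormedRing 𝔸] [NormedAlgebra ℂ 𝔸] [CompleteSpace 𝔸]
variable {S S' ι : Type*} [Fintype S] [Fintype S'] [Fintype ι] [LinearOrder ι]
variable (T : ι → Equiv.Perm S) (T' : ι → Equiv.Perm S') (e : S ≃ S') (he : ∀ (μ : ι) (x : S), e (T μ x) = T' μ (e x))

open B9Eq39Adjoint (R plaqU lettersA rem3 posPlaq mem_posPlaq bondPair)
open B11Eq26ActionExpansion (V0p eq30a)

omit [NormedAlgebra ℂ 𝔸] [CompleteSpace 𝔸] [Fintype S] [Fintype S'] [Fintype ι] [LinearOrder ι] in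
include he in
/-- The plaquette unit is natural: `U′(∂q)(e x) = U(∂q)(x)` for `U′ = U ∘ e⁻¹`. [folklore] [cite: Balaban1985BackgroundPropagators, (3.1) p.390] -/
theorem plaqU_transport (U : ι → S → 𝔸ˣ) (μ ν : ι) (x : S) :
    plaqU T' (fun κ y => U κ (e.symm y)) μ ν (e x) = plaqU T U μ ν x := by
  simp only [plaqU, ← he, Equiv.symm_apply_apply]

omit [NormedAlgebra ℂ 𝔸] [CompleteSpace 𝔸] [Fintype S] [Fintype S'] [Fintype ι] [LinearOrder ι] in
include he in
/-- The four bond letters of a plaquette are natural: `lettersA′(e x) = lettersA(x)` for `U′ = U ∘ e⁻¹`, `A′ = A ∘ e⁻¹`. [folklore] [cite: Balaban1985Variational, (34) p.283] -/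
theorem lettersA_transport (U : ι → S → 𝔸ˣ) (A : ι → S → 𝔸) (μ ν : ι) (x : S) :
    lettersA T' (fun κ y => U κ (e.symm y)) (fun κ y => A κ (e.symm y)) μ ν (e x) = lettersA T U A μ ν x := by
  simp only [lettersA, ← he, Equiv.symm_apply_apply]

omit [CompleteSpace 𝔸] [Fintype S] [Fintype S'] [Fintype ι] [LinearOrder ι] in
include he in
/-- `V₀(A, ∂p)` of (30) is natural under the site dictionary. [cite: Balaban1985Variational, (30) p.282] -/
theorem V0p_transport (U : ι → S → 𝔸ˣ) (η : ℝ) (τ : 𝔸 →ₗ[ℂ] ℂ) (A : ι → S → 𝔸) (μ ν : ι) (x : S) :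
    V0p T' (fun κ y => U κ (e.symm y)) η τ (fun κ y => A κ (e.symm y)) μ ν (e x) = V0p T U η τ A μ ν x := by
  simp only [V0p, rem3, lettersA_transport T T' e he, plaqU_transport T T' e he]

include he in
/-- **`V₀` OF (26)∕(30) IS NATURAL UNDER THE SITE DICTIONARY**: `V₀[T′, U ∘ e⁻¹](A ∘ e⁻¹) = V₀[T, U](A)` (tracial `τ`, `η ≠ 0`, `d ≥ 4`: the
plaquette sum (30) reindexed along `e`). [cite: Balaban1985Variational, (26) p.282, (30) p.282] -/
theorem V0_transport (U : ι → S → 𝔸ˣ) (η : ℝ) (hη : η ≠ 0) {d : ℕ} (hd : 4 ≤ d) (τ : 𝔸 →ₗ[ℂ] ℂ)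
    (hτ : ∀ a b : 𝔸, τ (a * b) = τ (b * a)) (A : ι → S → 𝔸) :
    B11Eq26ActionExpansion.V0 T' (fun κ y => U κ (e.symm y)) η d τ (fun κ y => A κ (e.symm y))
      = B11Eq26ActionExpansion.V0 T U η d τ A := by
  rw [eq30a T U τ hτ η hη hd, eq30a T' _ τ hτ η hη hd]
  refine Finset.sum_equiv ((e.prodCongr (Equiv.refl (ι × ι))).symm) (fun q => ?_) (fun q _ => ?_)
  · simp only [mem_posPlaq, Equiv.prodCongr_symm, Equiv.refl_symm, Equiv.prodCongr_apply, Prod.map_snd, Equiv.refl_apply]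
  · obtain ⟨y, μ, ν⟩ := q
    simp only [Equiv.prodCongr_symm, Equiv.refl_symm, Equiv.prodCongr_apply, Prod.map_apply, Equiv.refl_apply]
    rw [← V0p_transport T T' e he U η τ A μ ν (e.symm y), Equiv.apply_symm_apply]

omit [CompleteSpace 𝔸] [LinearOrder ι] in
/-- The bilinear pairing (27) `η^d Σ_x Σ_μ τ(A_μ(x)E_μ(x))` is natural under the site dictionary. [cite: Balaban1985Variational, (27) p.282] -/
theorem bondPair_transport (η : ℝ) (d : ℕ) (τ : 𝔸 →ₗ[ℂ] ℂ) (A E : ι → S → 𝔸) :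
    bondPair η d τ (fun κ y => A κ (e.symm y)) (fun κ y => E κ (e.symm y)) = bondPair η d τ A E := by
  unfold bondPair
  congr 1
  exact Fintype.sum_equiv e.symm _ _ fun y => rfl

end Natural

/-! ## §4 The V₀-group current AT THE SETUP TORUS `PBond P 0`, flat background, one level: UST's pointwise (98)-slot shape -/

section Slot

variable {P : Params}
variable {𝔸 : Type*} [NormedRing 𝔸] [NormedAlgebra ℂ 𝔸] [CompleteSpace 𝔸] [NormOneClass 𝔸] [StarRing 𝔸] [StarModule ℂ 𝔸]
  [FiniteDimensional ℂ 𝔸]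

open B11Eq63V0GroupCurrent (curV0 bondPair_curV0)
open B11Eq90V0primeCurrent (Tsh Ucur curL curL_apply differentiable_curV0prime)
open B11Eq26ActionExpansion (V0)
open B9Eq39Adjoint (bondPair)
open B11Eq96CommutatorCurrent (differentiable_curComm)
open B11Eq98V0LettersFlat (curV0_flat_oneLevel_quadBound)

/-- **THE V₀-GROUP's FUNCTIONAL DERIVATIVE AT THE FLAT BACKGROUND, ON THE SETUP TORUS, WITH THE POINTWISE (98)-SLOT OF THE (158) CONTRACTION.**
For every `Params` `P`, level `k` (weight `c = L^k = η_k⁻¹`), complete unital `*`-algebra `𝔸 ⊇ 𝔤ᶜ` (finite-dimensional) and letters `ρ`, `τ` (tracial,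
`*`-compatible, contractive): there is a map `W` on `PBond P 0 → 𝔸` — the V₀-group current `curV0 ρ τ 1` of [15] (90)–(96) read through a site dictionary —
with `sup‖Y‖ ≤ r ∧ L^k·sup‖Y(s+e_ν,μ) − Y(s,μ)‖ ≤ r ∧ r < 1/16 ⇒ sup‖W Y‖ ≤ (d−1)‖ρ‖(64+138‖τ‖)·r²` (UST `FlatSmallSolution158`'s `hWq` at `a₃ = 1/16`) and `W`
differentiable everywhere (its `hWd`). [cite: Balaban1985Variational, (98) p.293, Prop. 4 p.292, (158) p.302] -/
theorem exists_W_V0_flat (P : Params) (hd : 4 ≤ P.d) (k : ℕ) [Fact ((0 : ℝ) < (P.L : ℝ))] [Fact ((0 : ℝ) < ((P.L : ℝ))⁻¹ ^ k)]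
    (ρ : (𝔸 →L[ℂ] ℂ) →L[ℂ] 𝔸) (τ : 𝔸 →L[ℂ] ℂ) (hρ : ∀ (ℓ : 𝔸 →L[ℂ] ℂ) (X : 𝔸), τ (ρ ℓ * X) = ℓ X)
    (hτ : ∀ a b : 𝔸, τ (a * b) = τ (b * a)) (hτs : ∀ a : 𝔸, τ (star a) = starRingEnd ℂ (τ a)) (hτ1 : ∀ X : 𝔸, ‖τ X‖ ≤ ‖X‖) :
    ∃ (e : Site P 0 ≃ TSite P.d (fun _ => P.sitesPerDir 0)) (W : (PBond P 0 → 𝔸) → (PBond P 0 → 𝔸)),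
      (∀ (x : Site P 0) (μ : Fin P.d), e (x.shift μ) = B9SectCLatticeCarrier.shift μ (e x)) ∧
      (∀ (Y : PBond P 0 → 𝔸) (b : PBond P 0), W Y b =
        NegSup.equiv _ 𝔸 (curV0 (L := (P.L : ℝ)) (η := ((P.L : ℝ))⁻¹ ^ k)
          (lev₀ := fun _ : Bond P.d (fun _ => P.sitesPerDir 0) => k) (lev₁ := fun _ : Bond P.d (fun _ => P.sitesPerDir 0) × Fin P.d => k)
          (Dc := nabla115 (((P.L : ℝ))⁻¹ ^ k) (1 : Bond P.d (fun _ => P.sitesPerDir 0) → 𝔸ˣ)) ρ τ 1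
          ((JetSup.equiv _ _ _).symm fun b' => Y ⟨e.symm b'.1, b'.2⟩)) (e b.src, b.dir)) ∧
      (∀ (Y : PBond P 0 → 𝔸) (r : ℝ), r < 1 / 16 → (∀ b, ‖Y b‖ ≤ r) →
        (∀ (s : Site P 0) (μ ν : Fin P.d), (P.L : ℝ) ^ k * ‖Y ⟨s.shift ν, μ⟩ - Y ⟨s, μ⟩‖ ≤ r) →
        ∀ b, ‖W Y b‖ ≤ (((P.d - 1 : ℕ) : ℝ) * ‖ρ‖ * (64 + 138 * ‖τ‖)) * r ^ 2) ∧
      Differentiable ℂ W ∧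
      (∀ (Y δ : PBond P 0 → 𝔸),
        bondPair (((P.L : ℝ))⁻¹ ^ k) P.d (τ : 𝔸 →ₗ[ℂ] ℂ)
            (curL fun b' : Bond P.d (fun _ => P.sitesPerDir 0) => W Y ⟨e.symm b'.1, b'.2⟩)
            (curL fun b' : Bond P.d (fun _ => P.sitesPerDir 0) => δ ⟨e.symm b'.1, b'.2⟩)
          = deriv (fun t : ℂ => V0 Tsh (Ucur (1 : Bond P.d (fun _ => P.sitesPerDir 0) → 𝔸ˣ)) (((P.L : ℝ))⁻¹ ^ k) P.d
              (τ : 𝔸 →ₗ[ℂ] ℂ)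
              ((curL fun b' : Bond P.d (fun _ => P.sitesPerDir 0) => Y ⟨e.symm b'.1, b'.2⟩)
                + t • curL fun b' : Bond P.d (fun _ => P.sitesPerDir 0) => δ ⟨e.symm b'.1, b'.2⟩)) 0) ∧
      (∀ (Y δ : PBond P 0 → 𝔸),
        bondPair (((P.L : ℝ))⁻¹ ^ k) P.d (τ : 𝔸 →ₗ[ℂ] ℂ) (fun μ x => W Y ⟨x, μ⟩) (fun μ x => δ ⟨x, μ⟩)
          = deriv (fun t : ℂ => V0 (LatticeFieldCalculus.shiftEquiv (P := P) (j := 0)) (fun _ _ => (1 : 𝔸ˣ))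
              (((P.L : ℝ))⁻¹ ^ k) P.d (τ : 𝔸 →ₗ[ℂ] ℂ) ((fun μ x => Y ⟨x, μ⟩) + t • fun μ x => δ ⟨x, μ⟩)) 0) := by
  classical
  obtain ⟨e, he⟩ := exists_siteDictionary P 0
  have hL : (0 : ℝ) < (P.L : ℝ) := by exact_mod_cast P.L_pos
  have hL1 : (1 : ℝ) ≤ (P.L : ℝ) := by exact_mod_cast P.hL.2.le
  -- the carriers at one level `k`, weight 1, flat `∇`
  let Pd : Fin P.d → ℕ := fun _ => P.sitesPerDir 0
  let η : ℝ := ((P.L : ℝ))⁻¹ ^ k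
  let lev₀ : Bond P.d Pd → ℕ := fun _ => k
  let lev₁ : Bond P.d Pd × Fin P.d → ℕ := fun _ => k
  let Dc := nabla115 η (1 : Bond P.d Pd → 𝔸ˣ)
  let eY := JetSup.equiv (𝕜 := ℂ) (V := 𝔸) (levWeight (P.L : ℝ) η lev₀ 1) (levWeight (P.L : ℝ) η lev₁ 2) Dc
  let eZ := NegSup.equiv (levWeight (P.L : ℝ) η lev₀ 3) 𝔸
  -- transport in: a ℂ-linear map into the (115) carrier
  let Tinₗ : (PBond P 0 → 𝔸) →ₗ[ℂ] Space115 (P.L : ℝ) η lev₀ lev₁ Dc :=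
    { toFun := fun Y => eY.symm fun b' => Y ⟨e.symm b'.1, b'.2⟩
      map_add' := fun Y Z => rfl
      map_smul' := fun c Y => rfl }
  let Tin : (PBond P 0 → 𝔸) →L[ℂ] Space115 (P.L : ℝ) η lev₀ lev₁ Dc := LinearMap.toContinuousLinearMap Tinₗ
  -- transport out: a ℂ-linear map from the (−3) carrier
  let Toutₗ : NegSize (P.L : ℝ) η lev₀ 3 𝔸 →ₗ[ℂ] (PBond P 0 → 𝔸) :=
    { toFun := fun F b => eZ F (e b.src, b.dir)
      map_add' := fun F G => rfl
      map_smul' := fun c F => rfl }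
  let Tout : NegSize (P.L : ℝ) η lev₀ 3 𝔸 →L[ℂ] (PBond P 0 → 𝔸) := LinearMap.toContinuousLinearMap Toutₗ
  let cur := curV0 (L := (P.L : ℝ)) (η := η) (lev₀ := lev₀) (lev₁ := lev₁) (Dc := Dc) ρ τ 1
  -- the (63)/(27) certificate on the lit-balaban carrier
  have cert : ∀ (Y δ : PBond P 0 → 𝔸),
      bondPair η P.d (τ : 𝔸 →ₗ[ℂ] ℂ) (curL fun b' : Bond P.d Pd => Tout (cur (Tin Y)) ⟨e.symm b'.1, b'.2⟩)
          (curL fun b' : Bond P.d Pd => δ ⟨e.symm b'.1, b'.2⟩)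
        = deriv (fun t : ℂ => V0 Tsh (Ucur (1 : Bond P.d Pd → 𝔸ˣ)) η P.d (τ : 𝔸 →ₗ[ℂ] ℂ)
            ((curL fun b' : Bond P.d Pd => Y ⟨e.symm b'.1, b'.2⟩) + t • curL fun b' : Bond P.d Pd => δ ⟨e.symm b'.1, b'.2⟩)) 0 := by
    intro Y δ
    have hW : (fun b' : Bond P.d Pd => Tout (cur (Tin Y)) ⟨e.symm b'.1, b'.2⟩) = eZ (cur (Tin Y)) := by
      funext b'
      show eZ (cur (Tin Y)) (e (e.symm b'.1), b'.2) = eZ (cur (Tin Y)) b'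
      rw [Equiv.apply_symm_apply]
    rw [hW]
    exact bondPair_curV0 (lev₁ := lev₁) (Dc := Dc) ρ τ hρ hτ hd 1 (Tin Y) (fun b' => δ ⟨e.symm b'.1, b'.2⟩)
  have heT : ∀ (μ : Fin P.d) (x : Site P 0), e (LatticeFieldCalculus.shiftEquiv (P := P) (j := 0) μ x) = Tsh μ (e x) :=
    fun μ x => he x μ
  have hη0 : η ≠ 0 := (pow_pos (inv_pos.mpr hL) k).ne'
  refine ⟨e, fun Y => Tout (cur (Tin Y)), he, fun Y b => rfl, ?_, ?_, cert, ?_⟩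
  · intro Y r hr h0 h1 b
    -- `0 ≤ r` (the bond type is inhabited)
    have hr0 : 0 ≤ r := (norm_nonneg _).trans (h0 ⟨default, ⟨0, P.hd⟩⟩)
    have hT : ‖Tin Y‖ ≤ r := norm115_transport_le e he k Y hr0 h0 h1
    have hlt : ‖Tin Y‖ < 1 / 16 := lt_of_le_of_lt hT hr
    have hq := curV0_flat_oneLevel_quadBound (d := P.d) (Pd := Pd) (L := (P.L : ℝ)) (η := η) ρ τ hτ hτs hτ1 hL1 k (Tin Y) hlt
    have hC : 0 ≤ ((P.d - 1 : ℕ) : ℝ) * ‖ρ‖ * (64 + 138 * ‖τ‖) := by positivity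
    calc ‖Tout (cur (Tin Y)) b‖ = ‖eZ (cur (Tin Y)) (e b.src, b.dir)‖ := rfl
      _ ≤ ‖cur (Tin Y)‖ := apply_norm_le_negSize k _ _
      _ ≤ ((P.d - 1 : ℕ) : ℝ) * ‖ρ‖ * (64 + 138 * ‖τ‖) * ‖Tin Y‖ ^ 2 := hq
      _ ≤ ((P.d - 1 : ℕ) : ℝ) * ‖ρ‖ * (64 + 138 * ‖τ‖) * r ^ 2 := by
          gcongr
  · have hcur : Differentiable ℂ cur :=
      (differentiable_curV0prime (lev₁ := lev₁) (Dc := Dc) ρ τ 1).add (differentiable_curComm (lev₁ := lev₁) (Dc := Dc) ρ τ 1)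
    exact Tout.differentiable.comp (hcur.comp Tin.differentiable)
  · -- the certificate read back on the Setup torus: naturality of `bondPair` and `V₀` along `e`
    intro Y δ
    calc bondPair η P.d (τ : 𝔸 →ₗ[ℂ] ℂ) (fun μ x => Tout (cur (Tin Y)) ⟨x, μ⟩) (fun μ x => δ ⟨x, μ⟩)
        = bondPair η P.d (τ : 𝔸 →ₗ[ℂ] ℂ) (fun κ y => (fun μ x => Tout (cur (Tin Y)) ⟨x, μ⟩) κ (e.symm y))
            (fun κ y => (fun μ x => δ ⟨x, μ⟩) κ (e.symm y)) :=
          (bondPair_transport e η P.d (τ : 𝔸 →ₗ[ℂ] ℂ) _ _).symm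
      _ = bondPair η P.d (τ : 𝔸 →ₗ[ℂ] ℂ) (curL fun b' : Bond P.d Pd => Tout (cur (Tin Y)) ⟨e.symm b'.1, b'.2⟩)
            (curL fun b' : Bond P.d Pd => δ ⟨e.symm b'.1, b'.2⟩) := rfl
      _ = _ := cert Y δ
      _ = _ := by
          congr 1
          funext t
          exact V0_transport (LatticeFieldCalculus.shiftEquiv (P := P) (j := 0)) Tsh e heT (fun _ _ => (1 : 𝔸ˣ)) η hη0 hd
            (τ : 𝔸 →ₗ[ℂ] ℂ) hτ ((fun μ x => Y ⟨x, μ⟩) + t • fun μ x => δ ⟨x, μ⟩)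

end Slot

end Summit.QuantumFields.YangMills.Theorems.K0Stub1V0SlotAtRecord

end
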